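import Literature.Computability.MetaComplexity.TseitinDepthFregeBricks
import HarnessLib

/-!
# From a graph-Tseitin refutation to a grid-Tseitin refutation along a subdivided brick graph

The graph-theoretic half of the (conditional) discharge of
`Literature.Computability.MetaComplexity.galesiEtAl_tseitin_treewidth_depthFrege_lowerBound`
(Galesi–Itsykson–Riazanov–Sofronova, APAL 2023, §3: Lemmas 11–16 and the proof of Thm. 18).
Setting: a system `E : Fin m → LinEqMod 2 n` over `𝔽₂` in which every variable lies in exactly
two rows or in none (a multigraph Tseitin system: rows = charged vertices, variables = edges), its
row graph `G` (connected), and a subdivision of the brick graph `bricks k` inside `G`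
(`BrickEmbedding`). We build ONE substitution `σ` on the variables of `E` and show that every
clause of `sumEncoding 1 E`, after `σ`, is either a tautology or implied by one vertex block of the
grid Tseitin system `gridSystem k f''` for suitable charges `f''` (the clause-level check and the
application of `TextbookFrege.transfer_isDepthProofOf`, which turns a depth-`d` proof of `¬ T(E)`
into a depth-`(d + 23)` proof of `¬ T(𝓗_{k,k}, f'')` of polynomial size, are in
`TseitinDepthFregeProofs.lean`). This file: the embedding and its path variables
(`BrickEmbedding.pv`, `pv_injective`), Lemma 11 (`exists_offAssignment`), the parity gadgets
(`xorForm`, `signForm`), the substitution (`BrickEmbedding.subst`) and its semantics: the master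
identity `rowSum_zval` for the induced row parities and the four **row equations**
(`rowSum_zval_off`, `rowSum_zval_internal`, `rowSum_zval_left`, `rowSum_zval_right`). All
statements are proved.

The substitution (GIRS Lemmas 12, 15, 16 merged): variables off the subdivision are set to the
constants of an assignment `α` satisfying every row off the subdivision (Lemma 11, proved here by
flipping along walks: `exists_offAssignment`); the variables along the path of a grid edge `ε` of
the brick graph become literals `±y_ε`; the variables along the path of a matching edge at the
cell `w` become `±τ_w`, `τ_w` the parity of the charge of the left copy of `w` and the `≤ 2` grid
variables entering it (the contraction of the matching, Lemma 16); signs propagate the charges of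
the suppressed degree-`2` rows (Lemmas 13–14).

## References

* [GalesiEtAl2023] N. Galesi, D. Itsykson, A. Riazanov, A. Sofronova, *Bounded-depth Frege
  complexity of Tseitin formulas for all graphs*, Ann. Pure Appl. Logic 174 (2023) 103166, §3.1
  (Lemmas 10–15), §3.2 (Lemma 16), §3.3 (proof of Thm. 18). Read: APAL text pp. 10–16.
-/

namespace Literature.Computability.MetaComplexity

open Finset Literature.Combinatorics.SimpleGraph Bricks Complexity

/-! ### Graph-Tseitin systems: column weight two -/

section ColumnTwo

variable {n m : ℕ} (E : Fin m → LinEqMod 2 n)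

/-- `IsGraphSystem E G`: every variable of `E` lies in exactly two rows or in none, and `G` is the
row graph (two rows adjacent iff their supports meet) — the hypotheses of
`galesiEtAl_tseitin_treewidth_depthFrege_lowerBound`, bundled. [cite: GalesiEtAl2023, §2
(Tseitin formulas of multigraphs)] -/
structure IsGraphSystem (E : Fin m → LinEqMod 2 n) (G : SimpleGraph (Fin m)) : Prop where
  /-- column weight two or zero -/
  col : ∀ j : Fin n, (univ.filter fun i => j ∈ (E i).supp).card = 2 ∨
    (univ.filter fun i => j ∈ (E i).supp).card = 0
  /-- `G` is the row graph -/
  adj_iff : ∀ i i' : Fin m, G.Adj i i' ↔ i ≠ i' ∧ ((E i).supp ∩ (E i').supp).Nonempty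

variable {E} {G : SimpleGraph (Fin m)}

/-- Over `𝔽₂` a coefficient is `1` on the support. [folklore] -/
theorem coeff_eq_one_of_mem_supp {e : LinEqMod 2 n} {j : Fin n} (hj : j ∈ e.supp) : e.1 j = 1 := by
  have h : e.1 j ≠ 0 := (Finset.mem_filter.1 hj).2
  revert h; generalize e.1 j = x; revert x; decide

/-- Off the support a coefficient is `0`. [folklore] -/
theorem coeff_eq_zero_of_not_mem_supp {e : LinEqMod 2 n} {j : Fin n} (hj : j ∉ e.supp) : e.1 j = 0 := by
  by_contra h
  exact hj (Finset.mem_filter.2 ⟨Finset.mem_univ _, h⟩)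

/-- **Column weight two**: a variable common to two distinct rows lies in exactly these two rows.
[cite: GalesiEtAl2023, §2 (an edge joins two vertices)] -/
theorem mem_supp_iff_of_two (hE : IsGraphSystem E G) {j : Fin n} {a b : Fin m} (hab : a ≠ b)
    (ha : j ∈ (E a).supp) (hb : j ∈ (E b).supp) (r : Fin m) : j ∈ (E r).supp ↔ r = a ∨ r = b := by
  set S := univ.filter fun i => j ∈ (E i).supp with hS
  have haS : a ∈ S := by simp [hS, ha]
  have hbS : b ∈ S := by simp [hS, hb]
  have hcard : S.card = 2 := by
    rcases hE.col j with h | h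
    · exact h
    · exfalso
      rw [Finset.card_eq_zero] at h
      rw [hS, h] at haS
      simp at haS
  have hsub : ({a, b} : Finset (Fin m)) ⊆ S := by
    intro x hx; rcases Finset.mem_insert.1 hx with rfl | hx
    · exact haS
    · rw [Finset.mem_singleton.1 hx]; exact hbS
  have heq : ({a, b} : Finset (Fin m)) = S :=
    Finset.eq_of_subset_of_card_le hsub (by rw [hcard, Finset.card_pair hab])
  constructor
  · intro hr
    have : r ∈ S := by simp [hS, hr]
    rw [← heq] at this
    simpa using this
  · rintro (rfl | rfl)
    · exact ha
    · exact hb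

/-- The coefficient of a variable common to rows `a ≠ b`, in any row `r`, as an indicator.
[folklore] -/
theorem coeff_eq_indicator_of_two (hE : IsGraphSystem E G) {j : Fin n} {a b : Fin m} (hab : a ≠ b)
    (ha : j ∈ (E a).supp) (hb : j ∈ (E b).supp) (r : Fin m) :
    (E r).1 j = (if r = a then 1 else 0) + (if r = b then 1 else 0) := by
  by_cases hr : j ∈ (E r).supp
  · rw [coeff_eq_one_of_mem_supp hr]
    rcases (mem_supp_iff_of_two hE hab ha hb r).1 hr with rfl | rfl
    · simp [hab]
    · simp [hab.symm]
  · rw [coeff_eq_zero_of_not_mem_supp hr]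
    have := (mem_supp_iff_of_two hE hab ha hb r).not.1 hr
    push Not at this
    simp [this.1, this.2]

end ColumnTwo

/-! ### Subdivided brick graphs in the row graph -/

/-- A **subdivision of the brick graph `bricks k` in `G`** (the data of `bricks k ≼ₜ G` with the
paths oriented from left copies to right copies): branch vertices `f`, for every brick edge `e`
a path `P e` of `G` from `f (lend e, L)` to `f (rend e, R)` whose only branch vertices are its
ends, paths of distinct edges meeting only in branch vertices. [cite: GalesiEtAl2023, §2
(topological minors), Cor. 9] -/
structure BrickEmbedding {m : ℕ} (k : ℕ) (G : SimpleGraph (Fin m)) where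
  /-- the branch vertices -/
  f : (Fin (k + 1) × Fin (k + 1)) × Bool → Fin m
  /-- the subdivision path of a brick edge, from its left end to its right end -/
  P : ∀ e : BEdge k, G.Walk (f (lend e, false)) (f (rend e, true))
  /-- branch vertices are distinct -/
  f_inj : Function.Injective f
  /-- the paths are paths -/
  isPath : ∀ e, (P e).IsPath
  /-- the only branch vertices on a path are its ends -/
  branch : ∀ e w, f w ∈ (P e).support → w = (lend e, false) ∨ w = (rend e, true)
  /-- paths of distinct edges share only branch vertices -/
  disj : ∀ e e', e ≠ e' → ∀ x, x ∈ (P e).support → x ∈ (P e').support → x ∈ Set.range f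

/-- A topological brick minor yields a brick embedding. [cite: GalesiEtAl2023, §2] -/
theorem BrickEmbedding.nonempty_of_isTopologicalMinor {m k : ℕ} {G : SimpleGraph (Fin m)}
    (h : bricks k ≼ₜ G) : Nonempty (BrickEmbedding k G) := by
  obtain ⟨f, P, hf, hpath, hbranch, hdisj⟩ := h
  refine ⟨⟨f, fun e => P _ _ (bricks_adj_edge e), hf, fun e => hpath _ _ _,
    fun e w hw => hbranch _ _ _ w hw, fun e e' hne x hx hx' => hdisj _ _ _ _ _ _ ?_ x hx hx'⟩⟩
  intro heq
  apply hne
  rcases Sym2.eq_iff.1 heq with ⟨h1, h2⟩ | ⟨h1, h2⟩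
  · exact BEdge.ext_ends (congrArg Prod.fst h1) (congrArg Prod.fst h2)
  · exact absurd (congrArg Prod.snd h1) (by simp)

/-! ### Lemma 11: an assignment off the subdivision satisfying every row off the subdivision -/

section OffAssignment

variable {n m : ℕ} {E : Fin m → LinEqMod 2 n} {G : SimpleGraph (Fin m)}

/-- The parity `Σ_j a_{rj} [β j]` of the row `r` under the Boolean assignment `β`. [folklore] -/
def rowVal (E : Fin m → LinEqMod 2 n) (β : Fin n → Bool) (r : Fin m) : ZMod 2 :=
  ∑ j, (E r).1 j * (if β j then 1 else 0)

/-- Flipping one variable changes the parity of a row by the variable's coefficient. [folklore] -/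
theorem rowVal_update_not (E : Fin m → LinEqMod 2 n) (β : Fin n → Bool) (j : Fin n) (r : Fin m) :
    rowVal E (Function.update β j (!β j)) r = rowVal E β r + (E r).1 j := by
  unfold rowVal
  have h1 : ∀ i, (E r).1 i * (if Function.update β j (!β j) i then 1 else 0) =
      (E r).1 i * (if β i then 1 else 0) + (if i = j then (E r).1 j else 0) := by
    intro i
    by_cases hij : i = j
    · subst hij
      rw [Function.update_self, if_pos rfl]
      generalize (E r).1 i = a
      cases β i
      · simp
      · simp; revert a; decide
    · rw [Function.update_of_ne hij, if_neg hij, add_zero]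
  simp_rw [h1, Finset.sum_add_distrib, Finset.sum_ite_eq' Finset.univ j, Finset.mem_univ, if_true]

/-- A variable shared by the two ends of a dart of the row graph. [folklore] -/
noncomputable def dvar (hE : IsGraphSystem E G) (d : G.Dart) : Fin n :=
  ((hE.adj_iff _ _).1 d.adj).2.choose

/-- The dart variable lies in both end rows. [folklore] -/
theorem dvar_mem (hE : IsGraphSystem E G) (d : G.Dart) :
    dvar hE d ∈ (E d.fst).supp ∧ dvar hE d ∈ (E d.snd).supp :=
  Finset.mem_inter.1 ((hE.adj_iff _ _).1 d.adj).2.choose_spec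

/-- Flipping the variables along a list of darts. [folklore] -/
noncomputable def flipAlong (hE : IsGraphSystem E G) (β : Fin n → Bool) : List G.Dart → (Fin n → Bool)
  | [] => β
  | d :: ds => Function.update (flipAlong hE β ds) (dvar hE d) (!(flipAlong hE β ds (dvar hE d)))

/-- Flipping along a list of darts changes the parity of row `r` by the number of dart ends at
`r`. [folklore] -/
theorem rowVal_flipAlong (hE : IsGraphSystem E G) (β : Fin n → Bool) (r : Fin m) :
    ∀ ds : List G.Dart, rowVal E (flipAlong hE β ds) r = rowVal E β r +
      (ds.map fun d : G.Dart => (if r = d.fst then (1 : ZMod 2) else 0) + (if r = d.snd then 1 else 0)).sum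
  | [] => by simp [flipAlong]
  | d :: ds => by
    rw [flipAlong, rowVal_update_not, rowVal_flipAlong hE β r ds, List.map_cons, List.sum_cons,
      coeff_eq_indicator_of_two hE d.adj.ne (dvar_mem hE d).1 (dvar_mem hE d).2 r]
    ring

/-- Telescoping: along a walk from `a` to `c`, the dart ends at `r` number `[r = a] + [r = c]`
modulo `2`. [folklore] -/
theorem sum_darts_indicator {a c : Fin m} (w : G.Walk a c) (r : Fin m) :
    (w.darts.map fun d : G.Dart => (if r = d.fst then (1 : ZMod 2) else 0) + (if r = d.snd then 1 else 0)).sum =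
      (if r = a then 1 else 0) + (if r = c then 1 else 0) := by
  induction w with
  | nil =>
    simp only [SimpleGraph.Walk.darts_nil, List.map_nil, List.sum_nil]
    split_ifs <;> decide
  | @cons u v w' h p ih =>
    rw [SimpleGraph.Walk.darts_cons, List.map_cons, List.sum_cons, ih]
    show ((if r = u then (1 : ZMod 2) else 0) + (if r = v then 1 else 0)) +
        ((if r = v then 1 else 0) + (if r = w' then 1 else 0)) =
      (if r = u then 1 else 0) + (if r = w' then 1 else 0)
    generalize (if r = u then (1 : ZMod 2) else 0) = x
    generalize (if r = v then (1 : ZMod 2) else 0) = y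
    generalize (if r = w' then (1 : ZMod 2) else 0) = z
    revert x y z; decide

/-- A walk into a set `S` has an initial segment ending at its first vertex in `S`. [folklore] -/
theorem exists_walk_prefix (S : Set (Fin m)) [DecidablePred (· ∈ S)] :
    ∀ {a b : Fin m} (w : G.Walk a b), b ∈ S →
      ∃ c ∈ S, ∃ w' : G.Walk a c, ∀ x ∈ w'.support.dropLast, x ∉ S
  | a, _, SimpleGraph.Walk.nil, hb => ⟨a, hb, SimpleGraph.Walk.nil, by simp⟩
  | a, b, SimpleGraph.Walk.cons h w, hb => by
    by_cases ha : a ∈ S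
    · exact ⟨a, ha, SimpleGraph.Walk.nil, by simp⟩
    · obtain ⟨c, hc, w', hw'⟩ := exists_walk_prefix S w hb
      refine ⟨c, hc, SimpleGraph.Walk.cons h w', fun x hx => ?_⟩
      rw [SimpleGraph.Walk.support_cons, List.dropLast_cons_of_ne_nil (SimpleGraph.Walk.support_ne_nil _)] at hx
      rcases List.mem_cons.1 hx with rfl | hx
      · exact ha
      · exact hw' x hx

/-- **GIRS Lemma 11 (for the subdivision)**: there is an assignment to the variables under which
every row off a nonempty set `S` of rows is satisfied — provided the row graph is connected: flip
along a walk from a violated row to `S`, which repairs that row and disturbs only rows of `S`.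
(Printed for a connected subgraph `H` of `G`: "there exists a partial assignment … that does not
falsify any clause of `T(G,f)`"; rows of `H` keep unassigned variables.) [cite: GalesiEtAl2023,
Lemma 11] -/
theorem exists_offAssignment (hE : IsGraphSystem E G) (hconn : G.Connected) (S : Finset (Fin m))
    (hS : S.Nonempty) : ∃ β : Fin n → Bool, ∀ r ∉ S, rowVal E β r = (E r).2 := by
  classical
  -- induction on the number of violated rows off `S`
  suffices key : ∀ (N : ℕ) (β : Fin n → Bool),
      (univ.filter fun r => r ∉ S ∧ rowVal E β r ≠ (E r).2).card ≤ N →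
      ∃ β' : Fin n → Bool, ∀ r ∉ S, rowVal E β' r = (E r).2 from
    key _ (fun _ => false) le_rfl
  intro N
  induction N with
  | zero =>
    intro β hβ
    refine ⟨β, fun r hr => ?_⟩
    by_contra h
    have : r ∈ univ.filter fun r => r ∉ S ∧ rowVal E β r ≠ (E r).2 := by simp [hr, h]
    rw [Nat.le_zero, Finset.card_eq_zero] at hβ
    rw [hβ] at this; simp at this
  | succ N ih =>
    intro β hβ
    by_cases hex : ∃ a, a ∉ S ∧ rowVal E β a ≠ (E a).2
    · obtain ⟨a, haS, ha⟩ := hex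
      obtain ⟨s₀, hs₀⟩ := hS
      obtain ⟨w⟩ := hconn.preconnected a s₀
      obtain ⟨c, hc, w', hw'⟩ := exists_walk_prefix (↑S : Set (Fin m)) w (by exact_mod_cast hs₀)
      set β' := flipAlong hE β w'.darts with hβ'
      have hval : ∀ r, rowVal E β' r = rowVal E β r + ((if r = a then 1 else 0) + (if r = c then 1 else 0)) := by
        intro r; rw [hβ', rowVal_flipAlong, sum_darts_indicator]
      refine ih β' ?_
      -- the violated set loses `a`
      have hsub : (univ.filter fun r => r ∉ S ∧ rowVal E β' r ≠ (E r).2) ⊆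
          (univ.filter fun r => r ∉ S ∧ rowVal E β r ≠ (E r).2).erase a := by
        intro r hr
        simp only [Finset.mem_filter, Finset.mem_univ, true_and] at hr
        rw [Finset.mem_erase, Finset.mem_filter]
        have hrc : r ≠ c := fun h => hr.1 (h ▸ (by exact_mod_cast hc))
        rcases eq_or_ne r a with rfl | hra
        · exfalso
          apply hr.2
          rw [hval, if_pos rfl, if_neg hrc]
          revert ha; generalize rowVal E β r = x; generalize (E r).2 = y; revert x y; decide
        · refine ⟨hra, Finset.mem_univ _, hr.1, ?_⟩
          have := hr.2
          rwa [hval, if_neg hra, if_neg hrc, add_zero, add_zero] at this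
      have hmem : a ∈ univ.filter fun r => r ∉ S ∧ rowVal E β r ≠ (E r).2 := by simp [haS, ha]
      have := Finset.card_le_card hsub
      rw [Finset.card_erase_of_mem hmem] at this
      omega
    · push Not at hex
      exact ⟨β, hex⟩

end OffAssignment

/-! ### Parity gadgets -/

section Xor

open Complexity.PropForm

/-- `xorForm b xs`: a formula expressing `b ⊕ ⨁_{x ∈ xs} x` in the basis `¬, ∧, ∨`
(`(x ∧ ¬R) ∨ (¬x ∧ R)` recursively). Used only for `|xs| ≤ 2` (the parity of the `≤ 2` grid
edges entering the left copy of a cell: GIRS's constant-size CNF `τ_e` of Lemma 16).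
[cite: GalesiEtAl2023, Lemma 16 ("Let τ_e denote a CNF formula encoding ⊕ x_f = f(u_e)")] -/
def xorForm (b : Bool) : List ℕ → PropForm ℕ
  | [] => .const b
  | x :: xs => .disj (.conj (.var x) (.neg (xorForm b xs))) (.conj (.neg (.var x)) (xorForm b xs))

/-- Semantics of `xorForm`. [folklore] -/
theorem eval_xorForm (b : Bool) (ρ : ℕ → Bool) :
    ∀ xs : List ℕ, (xorForm b xs).eval ρ = xor b ((xs.map ρ).foldr xor false)
  | [] => by cases b <;> rfl
  | x :: xs => by
    simp only [xorForm, PropForm.eval, eval_xorForm b ρ xs, List.map_cons, List.foldr_cons]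
    cases b <;> cases ρ x <;> cases (xs.map ρ).foldr xor false <;> rfl

/-- Size of `xorForm`: `≤ 9 · 2^{|xs|}` (crudely). [folklore] -/
theorem size_xorForm_le (b : Bool) : ∀ xs : List ℕ, (xorForm b xs).size + 8 ≤ 9 * 2 ^ xs.length
  | [] => by simp [xorForm, PropForm.size]
  | x :: xs => by
    have := size_xorForm_le b xs
    simp only [xorForm, PropForm.size, List.length_cons, Nat.pow_succ]
    omega

/-- Depth of `xorForm`: every auxiliary depth is `≤ 3 |xs|`. [folklore] -/
theorem altDepthAux_xorForm_le (b : Bool) :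
    ∀ (xs : List ℕ) (c : ℕ), altDepthAux c (xorForm b xs) ≤ 3 * xs.length
  | [], c => Nat.zero_le _
  | x :: xs, c => by
    have h1 := altDepthAux_xorForm_le b xs 1
    have h2 := altDepthAux_xorForm_le b xs 2
    have hc : (if c = 3 then 0 else 1) ≤ 1 := by split_ifs <;> omega
    have e1 : (if (2 : ℕ) = 1 then (0 : ℕ) else 1) = 1 := by decide
    have e2 : (if (3 : ℕ) = 2 then (0 : ℕ) else 1) = 1 := by decide
    simp only [xorForm, PropForm.altDepthAux, List.length_cons, e1, e2]
    generalize (if c = 3 then 0 else 1) = i at *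
    omega

/-- Variables of `xorForm`. [folklore] -/
theorem mem_vars_xorForm {b : Bool} {xs : List ℕ} {y : ℕ} (h : y ∈ (xorForm b xs).vars) : y ∈ xs := by
  induction xs with
  | nil => simp [xorForm, PropForm.vars] at h
  | cons x xs ih =>
    simp only [xorForm, PropForm.vars, Finset.mem_union, Finset.mem_singleton] at h
    rcases h with (rfl | h) | (rfl | h)
    · simp
    · exact List.mem_cons_of_mem _ (ih h)
    · simp
    · exact List.mem_cons_of_mem _ (ih h)

/-- `signForm s A`: `A` if `s = 0`, `¬A` if `s = 1` (a literal of the formula `A` carrying the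
sign `s ∈ 𝔽₂`). [cite: GalesiEtAl2023, §3.1 (1-substitutions `x ↦ x_P` or `x ↦ ¬x_P`)] -/
def signForm (s : ZMod 2) (A : PropForm ℕ) : PropForm ℕ :=
  if s = 0 then A else .neg A

/-- Semantics of `signForm`: the value of `A` plus the sign, in `𝔽₂`. [folklore] -/
theorem eval_signForm_val (s : ZMod 2) (A : PropForm ℕ) (ρ : ℕ → Bool) :
    (if (signForm s A).eval ρ then (1 : ZMod 2) else 0) = s + (if A.eval ρ then 1 else 0) := by
  unfold signForm
  have hs : s = 0 ∨ s = 1 := by revert s; decide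
  rcases hs with rfl | rfl <;> cases h : A.eval ρ <;> simp [PropForm.eval, h]
  all_goals decide

/-- Size of `signForm`. [folklore] -/
theorem size_signForm_le (s : ZMod 2) (A : PropForm ℕ) : (signForm s A).size ≤ A.size + 1 := by
  unfold signForm; split_ifs <;> simp [PropForm.size]

/-- Depth of `signForm`. [folklore] -/
theorem altDepthAux_signForm_le (s : ZMod 2) (A : PropForm ℕ) {T : ℕ}
    (hA : ∀ c, altDepthAux c A ≤ T) (c : ℕ) : altDepthAux c (signForm s A) ≤ T + 1 := by
  unfold signForm
  split_ifs
  · exact (hA c).trans (Nat.le_succ _)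
  · have := hA 1
    simp only [PropForm.altDepthAux]; split_ifs <;> omega

/-- Variables of `signForm`. [folklore] -/
theorem vars_signForm (s : ZMod 2) (A : PropForm ℕ) : (signForm s A).vars = A.vars := by
  unfold signForm; split_ifs <;> simp [PropForm.vars]

end Xor

namespace BrickEmbedding

variable {n m k : ℕ} {E : Fin m → LinEqMod 2 n} {G : SimpleGraph (Fin m)} (B : BrickEmbedding k G)

/-- The `t`-th row on the path of `e` (`t = 0`: the left branch vertex; `t = ℓ`: the right one).
[folklore] -/
def row (e : BEdge k) (t : ℕ) : Fin m := (B.P e).getVert t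

/-- The length of the path of `e`. [folklore] -/
def len (e : BEdge k) : ℕ := (B.P e).length

/-- Paths have positive length (their ends are distinct branch vertices). [folklore] -/
theorem len_pos (e : BEdge k) : 0 < B.len e := by
  unfold len
  by_contra h
  push Not at h
  have h0 : (B.P e).length = 0 := Nat.le_zero.1 h
  have := SimpleGraph.Walk.eq_of_length_eq_zero h0
  have := B.f_inj this
  simp at this

/-- Consecutive rows of a path are adjacent. [folklore] -/
theorem adj_row_succ {e : BEdge k} {t : ℕ} (ht : t < B.len e) : G.Adj (B.row e t) (B.row e (t + 1)) :=
  (B.P e).adj_getVert_succ ht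

/-- Consecutive rows of a path share a variable. [folklore] -/
theorem exists_mem_inter (hE : IsGraphSystem E G) {e : BEdge k} {t : ℕ} (ht : t < B.len e) :
    ∃ j : Fin n, j ∈ (E (B.row e t)).supp ∧ j ∈ (E (B.row e (t + 1))).supp := by
  obtain ⟨-, j, hj⟩ := (hE.adj_iff _ _).1 (B.adj_row_succ ht)
  exact ⟨j, (Finset.mem_inter.1 hj).1, (Finset.mem_inter.1 hj).2⟩

/-- **The path variables**: `pv e t`, `t < len e`, is a variable common to the rows `row e t` and
`row e (t+1)` (an edge of the multigraph along the subdivision path; for `t ≥ len e` a junk copy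
of `pv e 0`). [cite: GalesiEtAl2023, §3.1 (the edges of the subgraph `H`)] -/
noncomputable def pv (hE : IsGraphSystem E G) (e : BEdge k) (t : ℕ) : Fin n :=
  if ht : t < B.len e then (B.exists_mem_inter hE ht).choose
  else (B.exists_mem_inter hE (B.len_pos e)).choose

/-- The path variable lies in the two consecutive rows. [folklore] -/
theorem pv_mem (hE : IsGraphSystem E G) {e : BEdge k} {t : ℕ} (ht : t < B.len e) :
    B.pv hE e t ∈ (E (B.row e t)).supp ∧ B.pv hE e t ∈ (E (B.row e (t + 1))).supp := by
  unfold pv; rw [dif_pos ht]; exact (B.exists_mem_inter hE ht).choose_spec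

/-- Rows along a path are pairwise distinct. [folklore] -/
theorem row_injOn (e : BEdge k) {t t' : ℕ} (ht : t ≤ B.len e) (ht' : t' ≤ B.len e)
    (h : B.row e t = B.row e t') : t = t' :=
  (B.isPath e).getVert_injOn ht ht' h

/-- The coefficient of a path variable in an arbitrary row: the indicator of its two rows.
[folklore] -/
theorem coeff_pv (hE : IsGraphSystem E G) {e : BEdge k} {t : ℕ} (ht : t < B.len e) (r : Fin m) :
    (E r).1 (B.pv hE e t) =
      (if r = B.row e t then 1 else 0) + (if r = B.row e (t + 1) then 1 else 0) := by
  have hne : B.row e t ≠ B.row e (t + 1) := fun h =>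
    absurd (B.row_injOn e ht.le ht h) (by omega)
  exact coeff_eq_indicator_of_two hE hne (B.pv_mem hE ht).1 (B.pv_mem hE ht).2 r

/-- A path variable lies in a row iff the row is one of its two rows. [folklore] -/
theorem pv_mem_iff (hE : IsGraphSystem E G) {e : BEdge k} {t : ℕ} (ht : t < B.len e) (r : Fin m) :
    B.pv hE e t ∈ (E r).supp ↔ r = B.row e t ∨ r = B.row e (t + 1) := by
  have hne : B.row e t ≠ B.row e (t + 1) := fun h =>
    absurd (B.row_injOn e ht.le ht h) (by omega)
  exact mem_supp_iff_of_two hE hne (B.pv_mem hE ht).1 (B.pv_mem hE ht).2 r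

/-- The first row of a path is its left branch vertex. [folklore] -/
@[simp] theorem row_zero (e : BEdge k) : B.row e 0 = B.f (lend e, false) := by simp [row]

/-- The last row of a path is its right branch vertex. [folklore] -/
@[simp] theorem row_len (e : BEdge k) : B.row e (B.len e) = B.f (rend e, true) := by
  simp [row, len]

/-- Rows of a path are on its support. [folklore] -/
theorem row_mem_support (e : BEdge k) (t : ℕ) : B.row e t ∈ (B.P e).support :=
  (B.P e).getVert_mem_support t

/-- Every support vertex is a row `row e t`, `t ≤ len e`. [folklore] -/
theorem exists_row_of_mem_support {e : BEdge k} {x : Fin m} (hx : x ∈ (B.P e).support) :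
    ∃ t ≤ B.len e, B.row e t = x := by
  obtain ⟨t, ht, htl⟩ := SimpleGraph.Walk.mem_support_iff_exists_getVert.1 hx
  exact ⟨t, htl, ht⟩

/-- An INTERNAL row of a path (index strictly between `0` and `len`) is not a branch vertex.
[folklore] -/
theorem row_ne_f {e : BEdge k} {t : ℕ} (ht0 : 0 < t) (ht : t < B.len e) (w) : B.row e t ≠ B.f w := by
  intro h
  rcases B.branch e w (h ▸ B.row_mem_support e t) with rfl | rfl
  · rw [← B.row_zero e] at h
    have := B.row_injOn e ht.le (Nat.zero_le _) h
    omega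
  · rw [← B.row_len e] at h
    have := B.row_injOn e ht.le le_rfl h
    omega

/-- An internal row of the path of `e` lies on no other path. [folklore] -/
theorem row_not_mem_support {e e' : BEdge k} (hne : e ≠ e') {t : ℕ} (ht0 : 0 < t) (ht : t < B.len e) :
    B.row e t ∉ (B.P e').support := by
  intro h
  obtain ⟨w, hw⟩ := B.disj e e' hne _ (B.row_mem_support e t) h
  exact B.row_ne_f ht0 ht w hw.symm

/-! ### Path variables are distinct -/

/-- **Path variables are pairwise distinct** (across positions and across edges).
[cite: GalesiEtAl2023, §3.1 (edges of a subdivision are distinct)] -/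
theorem pv_injective (hE : IsGraphSystem E G) {e e' : BEdge k} {t t' : ℕ} (ht : t < B.len e)
    (ht' : t' < B.len e') (h : B.pv hE e t = B.pv hE e' t') : e = e' ∧ t = t' := by
  -- the rows of `pv e t` are `row e t`, `row e (t+1)`; they lie on the path of `e'`
  have h1 : B.row e t = B.row e' t' ∨ B.row e t = B.row e' (t' + 1) :=
    (B.pv_mem_iff hE ht' _).1 (h ▸ (B.pv_mem hE ht).1)
  have h2 : B.row e (t + 1) = B.row e' t' ∨ B.row e (t + 1) = B.row e' (t' + 1) :=
    (B.pv_mem_iff hE ht' _).1 (h ▸ (B.pv_mem hE ht).2)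
  by_cases hee : e = e'
  · subst hee
    refine ⟨rfl, ?_⟩
    rcases h1 with h1 | h1
    · exact B.row_injOn e ht.le ht'.le h1
    · have := B.row_injOn e ht.le ht' h1
      rcases h2 with h2 | h2
      · have := B.row_injOn e ht ht'.le h2; omega
      · have := B.row_injOn e ht ht' h2; omega
  · exfalso
    have hon : ∀ s, B.row e s = B.row e' t' ∨ B.row e s = B.row e' (t' + 1) →
        B.row e s ∈ (B.P e').support := by
      rintro s (hs | hs) <;> rw [hs] <;> exact B.row_mem_support e' _
    -- an internal row of `e` would lie on the path of `e'`
    by_cases ht0 : 0 < t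
    · exact B.row_not_mem_support hee ht0 ht (hon t h1)
    · by_cases ht1 : t + 1 < B.len e
      · exact B.row_not_mem_support hee (Nat.succ_pos t) ht1 (hon (t + 1) h2)
      · -- `len e = 1`, `t = 0`: both rows of `e` are branch vertices on the path of `e'`
        have ht0' : t = 0 := by omega
        have hl : B.len e = 1 := by omega
        subst ht0'
        have hA : B.f (lend e, false) ∈ (B.P e').support := by simpa using hon 0 h1
        have hB : B.f (rend e, true) ∈ (B.P e').support := by
          have h3 : B.row e (B.len e) ∈ (B.P e').support := by rw [hl]; exact hon 1 h2
          rwa [B.row_len] at h3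
        rcases B.branch e' _ hA with hA | hA <;> rcases B.branch e' _ hB with hB | hB <;>
          simp only [Prod.mk.injEq, Bool.false_eq_true, Bool.true_eq_false, and_false, and_true] at hA hB
        exact hee (BEdge.ext_ends hA hB)

/-! ### The substitution -/

section Subst

open Classical in
/-- `OnPath j`: the variable `j` is one of the path variables. [folklore] -/
def OnPath (hE : IsGraphSystem E G) (j : Fin n) : Prop := ∃ e t, t < B.len e ∧ B.pv hE e t = j

variable (hE : IsGraphSystem E G) (α : Fin n → Bool)

open Classical in
/-- The off-path assignment, set to `false` on the path variables. [folklore] -/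
noncomputable def α₀ : Fin n → Bool := fun j => if B.OnPath hE j then false else α j

/-- The defect `q(r) = f(r) + Σ_{j off path} a_{rj} α_j` of a row: what the path variables through
`r` must contribute. [cite: GalesiEtAl2023, Lemma 13 (the charge `f_v`)] -/
noncomputable def q (r : Fin m) : ZMod 2 := (E r).2 + rowVal E (B.α₀ hE α) r

/-- The sign of the `t`-th variable on the path of `e`: the accumulated defects of the internal
rows `row e 1, …, row e t` (the composition of the 1-substitutions of the suppressed degree-2
vertices, Lemma 14). [cite: GalesiEtAl2023, Lemmas 13–14] -/
noncomputable def sgn (e : BEdge k) (t : ℕ) : ZMod 2 :=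
  (Finset.range t).sum fun i => B.q hE α (B.row e (i + 1))

/-- `sgn e 0 = 0`. [folklore] -/
@[simp] theorem sgn_zero (e : BEdge k) : B.sgn hE α e 0 = 0 := by simp [sgn]

/-- `sgn e (t+1) = sgn e t + q (row e (t+1))`. [folklore] -/
theorem sgn_succ (e : BEdge k) (t : ℕ) : B.sgn hE α e (t + 1) = B.sgn hE α e t + B.q hE α (B.row e (t + 1)) := by
  simp [sgn, Finset.sum_range_succ]

/-- The charge of the left copy of a cell: the defect of its branch vertex.
[cite: GalesiEtAl2023, Lemma 16 (the charges `f'`)] -/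
noncomputable def chL (w : Fin (k + 1) × Fin (k + 1)) : ZMod 2 := B.q hE α (B.f (w, false))

/-- The charge of the right copy of a cell: the defect of its branch vertex plus the signs
arriving along the paths ending there. [cite: GalesiEtAl2023, Lemma 16 (the charges `f'`)] -/
noncomputable def chR (w : Fin (k + 1) × Fin (k + 1)) : ZMod 2 :=
  B.q hE α (B.f (w, true)) + ∑ e ∈ univ.filter (fun e : BEdge k => rend e = w), B.sgn hE α e (B.len e - 1)

/-- The charge of the grid vertex `w` after contracting the matching edge at `w`:
`f''(w) = f'(w_L) + f'(w_R)`. [cite: GalesiEtAl2023, Lemma 16 ("f'(w) = (f(w') + f(w'')) mod 2")] -/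
noncomputable def charge (w : Fin (k + 1) × Fin (k + 1)) : ZMod 2 := B.chL hE α w + B.chR hE α w

end Subst

end BrickEmbedding

/-- The variable index of a grid edge in `gridSystem k f`. [folklore] -/
noncomputable def gi (k : ℕ) (ε : GridEdge k) : ℕ := (Fintype.equivFin (GridEdge k) ε : ℕ)

/-- `gi` is injective. [folklore] -/
theorem gi_injective (k : ℕ) : Function.Injective (gi k) := fun _ _ h =>
  (Fintype.equivFin (GridEdge k)).injective (Fin.ext h)

/-- The grid edges whose first (left-copy) end is the cell `w`. [folklore] -/
def leftEdges {k : ℕ} (w : Fin (k + 1) × Fin (k + 1)) : Finset (GridEdge k) :=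
  univ.filter fun ε => (gridEnds ε).1 = w

/-- The grid edges whose second (right-copy) end is the cell `w`. [folklore] -/
def rightEdges {k : ℕ} (w : Fin (k + 1) × Fin (k + 1)) : Finset (GridEdge k) :=
  univ.filter fun ε => (gridEnds ε).2 = w

/-- At most two grid edges enter the left copy of a cell (one horizontal, one vertical).
[cite: GalesiEtAl2023, Lemma 16 ("the size of τ_e is O(1)")] -/
theorem card_leftEdges_le {k : ℕ} (w : Fin (k + 1) × Fin (k + 1)) : (leftEdges w).card ≤ 2 := by
  have h : Set.InjOn (fun ε : GridEdge k => ε.isLeft) ↑(leftEdges w) := by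
    rintro (⟨i, c⟩ | ⟨i, c⟩) hε (⟨i', c'⟩ | ⟨i', c'⟩) hε' heq <;>
      simp only [leftEdges, Finset.coe_filter, Set.mem_setOf_eq, Finset.mem_univ, true_and,
        gridEnds_inl, gridEnds_inr, Sum.isLeft_inl, Sum.isLeft_inr, Bool.false_eq_true,
        Bool.true_eq_false] at hε hε' heq
    · rw [← hε'] at hε
      simp only [Prod.mk.injEq] at hε
      rw [hε.1, Fin.succ_inj.1 hε.2]
    · rw [← hε'] at hε
      simp only [Prod.mk.injEq] at hε
      rw [Fin.castSucc_inj.1 hε.1, hε.2]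
  calc (leftEdges w).card ≤ (Finset.univ : Finset Bool).card :=
        Finset.card_le_card_of_injOn _ (fun _ _ => Finset.mem_univ _) h
    _ = 2 := rfl

namespace BrickEmbedding

section Subst

variable {n m k : ℕ} {E : Fin m → LinEqMod 2 n} {G : SimpleGraph (Fin m)} (B : BrickEmbedding k G)
  (hE : IsGraphSystem E G) (α : Fin n → Bool)

/-- `τ_w`: the formula substituted for the variables on the path of the matching edge at `w` —
the parity of the charge of the left copy of `w` and of the `≤ 2` grid variables entering it (the
contraction of the matching edge, GIRS Lemma 16). [cite: GalesiEtAl2023, Lemma 16 (τ_e)] -/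
noncomputable def tauForm (w : Fin (k + 1) × Fin (k + 1)) : PropForm ℕ :=
  xorForm (decide (B.chL hE α w = 1)) ((leftEdges w).toList.map (gi k))

/-- The formula carried (up to sign) by every variable on the path of a brick edge: the grid
variable `y_ε` for a grid edge, `τ_w` for the matching edge at `w`.
[cite: GalesiEtAl2023, Lemmas 15–16] -/
noncomputable def baseForm : BEdge k → PropForm ℕ
  | Sum.inl w => B.tauForm hE α w
  | Sum.inr ε => PropForm.var (gi k ε)

open Classical in
/-- **The substitution** `σ` on the variables of `E`: a path variable `pv e t` becomes
`± baseForm e` with sign `sgn e t`; every other variable becomes the constant `α j`; indices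
`≥ n` (not variables of `E`) are left alone. [cite: GalesiEtAl2023, §3.1–3.2 (the substitutions
of Lemmas 12, 15 and 16, composed)] -/
noncomputable def subst : ℕ → PropForm ℕ := fun j =>
  if hj : j < n then
    if h : B.OnPath hE ⟨j, hj⟩ then
      signForm (B.sgn hE α h.choose h.choose_spec.choose) (B.baseForm hE α h.choose)
    else PropForm.const (α ⟨j, hj⟩)
  else PropForm.var j

/-- The substitution on an off-path variable. [folklore] -/
theorem subst_of_not_onPath {j : Fin n} (h : ¬ B.OnPath hE j) :
    B.subst hE α j = PropForm.const (α j) := by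
  unfold subst
  rw [dif_pos j.isLt, dif_neg (by simpa using h)]

/-- The substitution on a path variable. [folklore] -/
theorem subst_pv {e : BEdge k} {t : ℕ} (ht : t < B.len e) :
    B.subst hE α (B.pv hE e t) = signForm (B.sgn hE α e t) (B.baseForm hE α e) := by
  classical
  unfold subst
  have hon : B.OnPath hE ⟨(B.pv hE e t : ℕ), (B.pv hE e t).isLt⟩ := ⟨e, t, ht, by simp⟩
  rw [dif_pos (B.pv hE e t).isLt, dif_pos hon]
  have h1 := hon.choose_spec.choose_spec
  obtain ⟨he, hte⟩ := B.pv_injective hE h1.1 ht (by simpa [Fin.ext_iff] using h1.2)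
  have key : ∀ (e₁ e₂ : BEdge k) (t₁ t₂ : ℕ), e₁ = e₂ → t₁ = t₂ →
      signForm (B.sgn hE α e₁ t₁) (B.baseForm hE α e₁) = signForm (B.sgn hE α e₂ t₂) (B.baseForm hE α e₂) := by
    rintro _ _ _ _ rfl rfl; rfl
  exact key _ _ _ _ he hte

/-! ### Semantic values under an assignment of the grid variables -/

variable (ρ : ℕ → Bool)

/-- The value of the grid variable of `ε` under `ρ`, in `𝔽₂`. [folklore] -/
noncomputable def yv (ε : GridEdge k) : ZMod 2 := if ρ (gi k ε) then 1 else 0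

/-- The value of `baseForm e` under `ρ`, in `𝔽₂`. [folklore] -/
noncomputable def Yval : BEdge k → ZMod 2
  | Sum.inl w => B.chL hE α w + ∑ ε ∈ leftEdges w, yv ρ ε
  | Sum.inr ε => yv ρ ε

/-- Boolean xor-folds as sums in `𝔽₂`. [folklore] -/
theorem ite_foldr_xor {ι : Type*} (g : ι → Bool) :
    ∀ L : List ι, (if (L.map g).foldr xor false then (1 : ZMod 2) else 0) =
      (L.map fun x => if g x then (1 : ZMod 2) else 0).sum
  | [] => by simp
  | x :: L => by
    rw [List.map_cons, List.foldr_cons, List.map_cons, List.sum_cons, ← ite_foldr_xor g L]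
    cases g x <;> cases (L.map g).foldr xor false <;> simp [CharTwo.add_self_eq_zero]

/-- Semantics of `baseForm`. [folklore] -/
theorem val_baseForm (e : BEdge k) :
    (if (B.baseForm hE α e).eval ρ then (1 : ZMod 2) else 0) = B.Yval hE α ρ e := by
  rcases e with w | ε
  · simp only [baseForm, tauForm, eval_xorForm, Yval]
    have h1 := ite_foldr_xor ρ ((leftEdges w).toList.map (gi k))
    rw [List.map_map] at h1
    have h2 : (((leftEdges w).toList.map (gi k)).map ρ) = ((leftEdges w).toList.map (ρ ∘ gi k)) := by
      rw [List.map_map]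
    rw [h2]
    have h3 : (if ((leftEdges w).toList.map (ρ ∘ gi k)).foldr xor false then (1 : ZMod 2) else 0) =
        ∑ ε ∈ leftEdges w, yv ρ ε := by
      rw [ite_foldr_xor, Finset.sum_map_toList]; rfl
    have hc : B.chL hE α w = 0 ∨ B.chL hE α w = 1 := by
      generalize B.chL hE α w = x; revert x; decide
    rw [← h3]
    rcases hc with hc | hc <;> rw [hc] <;>
      cases ((leftEdges w).toList.map (ρ ∘ gi k)).foldr xor false <;>
      simp [CharTwo.add_self_eq_zero]
  · simp [baseForm, Yval, yv, PropForm.eval]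

/-- The value induced on the variable `j` of `E` by `σ` and `ρ`. [folklore] -/
noncomputable def zval (j : Fin n) : ZMod 2 := if (B.subst hE α j).eval ρ then 1 else 0

/-- Induced value of an off-path variable. [folklore] -/
theorem zval_of_not_onPath {j : Fin n} (h : ¬ B.OnPath hE j) :
    B.zval hE α ρ j = if α j then 1 else 0 := by
  simp [zval, B.subst_of_not_onPath hE α h, PropForm.eval]

/-- Induced value of a path variable: its sign plus the value of its base formula. [folklore] -/
theorem zval_pv {e : BEdge k} {t : ℕ} (ht : t < B.len e) :
    B.zval hE α ρ (B.pv hE e t) = B.sgn hE α e t + B.Yval hE α ρ e := by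
  rw [zval, B.subst_pv hE α ht, eval_signForm_val, B.val_baseForm]

end Subst


/-! ### The induced row parities: master identity -/

section Rows

variable {n m k : ℕ} {E : Fin m → LinEqMod 2 n} {G : SimpleGraph (Fin m)} (B : BrickEmbedding k G)
  (hE : IsGraphSystem E G) (α : Fin n → Bool) (ρ : ℕ → Bool)

/-- The contribution `sgn e t + Yval e` of the `t`-th variable of the path of `e`. [folklore] -/
noncomputable def v (e : BEdge k) (t : ℕ) : ZMod 2 := B.sgn hE α e t + B.Yval hE α ρ e

/-- Pointwise form of the induced values: the zeroed off-path assignment plus the contributions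
of the path variable that `j` is (if any). [folklore] -/
theorem zval_eq (j : Fin n) :
    B.zval hE α ρ j = (if B.α₀ hE α j then 1 else 0) +
      ∑ e, ∑ t ∈ Finset.range (B.len e), (if B.pv hE e t = j then B.v hE α ρ e t else 0) := by
  classical
  by_cases h : B.OnPath hE j
  · obtain ⟨e₀, t₀, ht₀, rfl⟩ := h
    rw [B.zval_pv hE α ρ ht₀]
    have hα : B.α₀ hE α (B.pv hE e₀ t₀) = false := by
      simp only [α₀]; rw [if_pos ⟨e₀, t₀, ht₀, rfl⟩]
    rw [hα]
    simp only [Bool.false_eq_true, if_false, zero_add]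
    rw [Finset.sum_eq_single e₀]
    · rw [Finset.sum_eq_single_of_mem t₀ (Finset.mem_range.2 ht₀)]
      · simp [v]
      · intro t ht htne
        rw [if_neg]
        intro heq
        exact htne (B.pv_injective hE (Finset.mem_range.1 ht) ht₀ heq).2
    · intro e _ hne
      refine Finset.sum_eq_zero fun t ht => ?_
      rw [if_neg]
      intro heq
      exact hne (B.pv_injective hE (Finset.mem_range.1 ht) ht₀ heq).1
    · simp
  · rw [B.zval_of_not_onPath hE α ρ h]
    have hα : B.α₀ hE α j = α j := by simp only [α₀]; rw [if_neg h]
    rw [hα]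
    have h0 : ∑ e, ∑ t ∈ Finset.range (B.len e), (if B.pv hE e t = j then B.v hE α ρ e t else 0) = 0 := by
      refine Finset.sum_eq_zero fun e _ => Finset.sum_eq_zero fun t ht => ?_
      rw [if_neg]
      intro heq
      exact h ⟨e, t, Finset.mem_range.1 ht, heq⟩
    rw [h0, add_zero]

/-- **Master identity**: the parity of row `r` under the induced values is its off-path parity
plus, for every path variable, its contribution times the number of its rows equal to `r`.
[cite: GalesiEtAl2023, Lemmas 12–16 (the substituted parity conditions)] -/
theorem rowSum_zval (r : Fin m) :
    ∑ j, (E r).1 j * B.zval hE α ρ j = rowVal E (B.α₀ hE α) r +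
      ∑ e, ∑ t ∈ Finset.range (B.len e), B.v hE α ρ e t *
        ((if r = B.row e t then 1 else 0) + (if r = B.row e (t + 1) then 1 else 0)) := by
  classical
  -- the inner single-variable sum
  have hin : ∀ (e : BEdge k) (t : ℕ), t ∈ Finset.range (B.len e) →
      ∑ j, (E r).1 j * (if B.pv hE e t = j then B.v hE α ρ e t else 0) =
        B.v hE α ρ e t * ((if r = B.row e t then 1 else 0) + (if r = B.row e (t + 1) then 1 else 0)) := by
    intro e t ht
    have hlt : t < B.len e := Finset.mem_range.1 ht
    rw [Finset.sum_eq_single (B.pv hE e t)]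
    · rw [if_pos rfl, B.coeff_pv hE hlt r, mul_comm]
    · intro j _ hj; rw [if_neg (Ne.symm hj), mul_zero]
    · simp
  have h2 : ∑ j, (E r).1 j * ∑ e, ∑ t ∈ Finset.range (B.len e),
        (if B.pv hE e t = j then B.v hE α ρ e t else 0) =
      ∑ e, ∑ t ∈ Finset.range (B.len e), B.v hE α ρ e t *
        ((if r = B.row e t then 1 else 0) + (if r = B.row e (t + 1) then 1 else 0)) := by
    simp_rw [Finset.mul_sum]
    conv_lhs => rw [Finset.sum_comm]
    refine Finset.sum_congr rfl fun e _ => ?_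
    conv_lhs => rw [Finset.sum_comm]
    exact Finset.sum_congr rfl fun t ht => hin e t ht
  have h1 : ∀ j, (E r).1 j * B.zval hE α ρ j = (E r).1 j * (if B.α₀ hE α j then 1 else 0) +
      (E r).1 j * ∑ e, ∑ t ∈ Finset.range (B.len e),
        (if B.pv hE e t = j then B.v hE α ρ e t else 0) := fun j => by
    rw [B.zval_eq hE α ρ j, mul_add]
  rw [Finset.sum_congr rfl (fun j _ => h1 j), Finset.sum_add_distrib, h2]
  rfl

/-! ### Which path variables pass through a given row -/

/-- A row of a path equals a branch vertex only at the ends. [folklore] -/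
theorem row_eq_f_iff {e : BEdge k} {t : ℕ} (ht : t ≤ B.len e) (w : (Fin (k + 1) × Fin (k + 1)) × Bool) :
    B.row e t = B.f w ↔ (t = 0 ∧ w = (lend e, false)) ∨ (t = B.len e ∧ w = (rend e, true)) := by
  constructor
  · intro h
    rcases B.branch e w (h ▸ B.row_mem_support e t) with rfl | rfl
    · left
      refine ⟨?_, rfl⟩
      rw [← B.row_zero e] at h
      exact B.row_injOn e ht (Nat.zero_le _) h
    · right
      refine ⟨?_, rfl⟩
      rw [← B.row_len e] at h
      exact B.row_injOn e ht le_rfl h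
  · rintro (⟨rfl, rfl⟩ | ⟨rfl, rfl⟩)
    · exact B.row_zero e
    · exact B.row_len e

/-- The first half of the path-variable sum, at an INTERNAL row. [folklore] -/
theorem sum_fst_internal {e₀ : BEdge k} {t₀ : ℕ} (h0 : 0 < t₀) (h1 : t₀ < B.len e₀) :
    ∑ e, ∑ t ∈ Finset.range (B.len e), (if B.row e₀ t₀ = B.row e t then B.v hE α ρ e t else 0) =
      B.v hE α ρ e₀ t₀ := by
  classical
  rw [Finset.sum_eq_single e₀]
  · rw [Finset.sum_eq_single_of_mem t₀ (Finset.mem_range.2 h1)]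
    · rw [if_pos rfl]
    · intro t ht hne
      rw [if_neg]
      intro heq
      exact hne (B.row_injOn e₀ (Finset.mem_range.1 ht).le h1.le heq.symm)
  · intro e _ hne
    refine Finset.sum_eq_zero fun t _ => ?_
    rw [if_neg]
    intro heq
    exact B.row_not_mem_support (Ne.symm hne) h0 h1 (heq ▸ B.row_mem_support e t)
  · simp

/-- The second half of the path-variable sum, at an INTERNAL row. [folklore] -/
theorem sum_snd_internal {e₀ : BEdge k} {t₀ : ℕ} (h0 : 0 < t₀) (h1 : t₀ < B.len e₀) :
    ∑ e, ∑ t ∈ Finset.range (B.len e), (if B.row e₀ t₀ = B.row e (t + 1) then B.v hE α ρ e t else 0) =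
      B.v hE α ρ e₀ (t₀ - 1) := by
  classical
  rw [Finset.sum_eq_single e₀]
  · rw [Finset.sum_eq_single_of_mem (t₀ - 1) (Finset.mem_range.2 (by omega))]
    · rw [if_pos]; congr 1; omega
    · intro t ht hne
      rw [if_neg]
      intro heq
      have := B.row_injOn e₀ h1.le (Finset.mem_range.1 ht) heq
      omega
  · intro e _ hne
    refine Finset.sum_eq_zero fun t _ => ?_
    rw [if_neg]
    intro heq
    exact B.row_not_mem_support (Ne.symm hne) h0 h1 (heq ▸ B.row_mem_support e (t + 1))
  · simp

/-- The first half of the path-variable sum, at a LEFT branch vertex: the paths starting there.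
[folklore] -/
theorem sum_fst_left (u : Fin (k + 1) × Fin (k + 1)) :
    ∑ e, ∑ t ∈ Finset.range (B.len e), (if B.f (u, false) = B.row e t then B.v hE α ρ e t else 0) =
      ∑ e ∈ univ.filter (fun e : BEdge k => lend e = u), B.v hE α ρ e 0 := by
  classical
  rw [Finset.sum_filter]
  refine Finset.sum_congr rfl fun e _ => ?_
  have key : ∀ t ∈ Finset.range (B.len e), (B.f (u, false) = B.row e t ↔ t = 0 ∧ lend e = u) := by
    intro t ht
    rw [eq_comm, B.row_eq_f_iff (Finset.mem_range.1 ht).le]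
    have := Finset.mem_range.1 ht
    constructor
    · rintro (⟨rfl, h⟩ | ⟨h, h'⟩)
      · exact ⟨rfl, by simpa using h.symm⟩
      · simp at h'
    · rintro ⟨rfl, rfl⟩; exact Or.inl ⟨rfl, rfl⟩
  rw [Finset.sum_congr rfl fun t ht => if_congr (key t ht) rfl rfl]
  by_cases hu : lend e = u
  · rw [if_pos hu, Finset.sum_eq_single_of_mem 0 (Finset.mem_range.2 (B.len_pos e))]
    · simp [hu]
    · intro t _ ht0; rw [if_neg]; rintro ⟨h, -⟩; exact ht0 h
  · rw [if_neg hu]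
    exact Finset.sum_eq_zero fun t _ => by rw [if_neg]; rintro ⟨-, h⟩; exact hu h

/-- The second half of the path-variable sum vanishes at a LEFT branch vertex. [folklore] -/
theorem sum_snd_left (u : Fin (k + 1) × Fin (k + 1)) :
    ∑ e, ∑ t ∈ Finset.range (B.len e), (if B.f (u, false) = B.row e (t + 1) then B.v hE α ρ e t else 0) = 0 := by
  classical
  refine Finset.sum_eq_zero fun e _ => Finset.sum_eq_zero fun t ht => ?_
  rw [if_neg]
  intro h
  rw [eq_comm, B.row_eq_f_iff (Finset.mem_range.1 ht)] at h
  rcases h with ⟨h, -⟩ | ⟨-, h⟩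
  · omega
  · simp at h

/-- The first half of the path-variable sum vanishes at a RIGHT branch vertex. [folklore] -/
theorem sum_fst_right (w : Fin (k + 1) × Fin (k + 1)) :
    ∑ e, ∑ t ∈ Finset.range (B.len e), (if B.f (w, true) = B.row e t then B.v hE α ρ e t else 0) = 0 := by
  classical
  refine Finset.sum_eq_zero fun e _ => Finset.sum_eq_zero fun t ht => ?_
  rw [if_neg]
  intro h
  have hlt := Finset.mem_range.1 ht
  rw [eq_comm, B.row_eq_f_iff hlt.le] at h
  rcases h with ⟨-, h⟩ | ⟨h, -⟩
  · simp at h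
  · omega

/-- The second half of the path-variable sum, at a RIGHT branch vertex: the paths ending there.
[folklore] -/
theorem sum_snd_right (w : Fin (k + 1) × Fin (k + 1)) :
    ∑ e, ∑ t ∈ Finset.range (B.len e), (if B.f (w, true) = B.row e (t + 1) then B.v hE α ρ e t else 0) =
      ∑ e ∈ univ.filter (fun e : BEdge k => rend e = w), B.v hE α ρ e (B.len e - 1) := by
  classical
  rw [Finset.sum_filter]
  refine Finset.sum_congr rfl fun e _ => ?_
  have key : ∀ t ∈ Finset.range (B.len e),
      (B.f (w, true) = B.row e (t + 1) ↔ t = B.len e - 1 ∧ rend e = w) := by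
    intro t ht
    have hlt := Finset.mem_range.1 ht
    rw [eq_comm, B.row_eq_f_iff (by omega)]
    constructor
    · rintro (⟨h, -⟩ | ⟨h, h'⟩)
      · omega
      · exact ⟨by omega, by simpa using h'.symm⟩
    · rintro ⟨rfl, rfl⟩; exact Or.inr ⟨by omega, rfl⟩
  rw [Finset.sum_congr rfl fun t ht => if_congr (key t ht) rfl rfl]
  by_cases hw : rend e = w
  · rw [if_pos hw, Finset.sum_eq_single_of_mem (B.len e - 1) (Finset.mem_range.2 (by have := B.len_pos e; omega))]
    · simp [hw]
    · intro t _ ht0; rw [if_neg]; rintro ⟨h, -⟩; exact ht0 h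
  · rw [if_neg hw]
    exact Finset.sum_eq_zero fun t _ => by rw [if_neg]; rintro ⟨-, h⟩; exact hw h

/-- Both halves vanish at a row off the subdivision. [folklore] -/
theorem sum_off {r : Fin m} (hr : ∀ e, r ∉ (B.P e).support) (b : Bool) :
    ∑ e, ∑ t ∈ Finset.range (B.len e),
      (if r = B.row e (t + if b then 1 else 0) then B.v hE α ρ e t else 0) = 0 := by
  classical
  refine Finset.sum_eq_zero fun e _ => Finset.sum_eq_zero fun t _ => ?_
  rw [if_neg]
  intro h
  exact hr e (h ▸ B.row_mem_support e _)

end Rows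


/-! ### The edges at a cell -/

/-- Sum over the brick edges whose LEFT end is `u`: the matching edge at `u` and the grid edges
entering the left copy of `u`. [folklore] -/
theorem sum_filter_lend_eq {k : ℕ} {M : Type*} [AddCommMonoid M] (F : BEdge k → M) (u : Fin (k + 1) × Fin (k + 1)) :
    ∑ e ∈ univ.filter (fun e : BEdge k => lend e = u), F e = F (Sum.inl u) + ∑ ε ∈ leftEdges u, F (Sum.inr ε) := by
  classical
  rw [Finset.sum_filter, Fintype.sum_sum_type]
  congr 1
  · rw [Finset.sum_eq_single_of_mem u (Finset.mem_univ _)]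
    · exact if_pos rfl
    · exact fun b _ hb => if_neg hb
  · rw [leftEdges, Finset.sum_filter]; rfl

/-- Sum over the brick edges whose RIGHT end is `w`: the matching edge at `w` and the grid edges
entering the right copy of `w`. [folklore] -/
theorem sum_filter_rend_eq {k : ℕ} {M : Type*} [AddCommMonoid M] (F : BEdge k → M) (w : Fin (k + 1) × Fin (k + 1)) :
    ∑ e ∈ univ.filter (fun e : BEdge k => rend e = w), F e = F (Sum.inl w) + ∑ ε ∈ rightEdges w, F (Sum.inr ε) := by
  classical
  rw [Finset.sum_filter, Fintype.sum_sum_type]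
  congr 1
  · rw [Finset.sum_eq_single_of_mem w (Finset.mem_univ _)]
    · exact if_pos rfl
    · exact fun b _ hb => if_neg hb
  · rw [rightEdges, Finset.sum_filter]; rfl

/-! ### The four row equations -/

section RowEquations

variable {n m k : ℕ} {E : Fin m → LinEqMod 2 n} {G : SimpleGraph (Fin m)} (B : BrickEmbedding k G)
  (hE : IsGraphSystem E G) (α : Fin n → Bool) (ρ : ℕ → Bool)

/-- The master identity with the two halves separated. [folklore] -/
theorem rowSum_zval_split (r : Fin m) :
    ∑ j, (E r).1 j * B.zval hE α ρ j = rowVal E (B.α₀ hE α) r +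
      ∑ e, ∑ t ∈ Finset.range (B.len e), (if r = B.row e t then B.v hE α ρ e t else 0) +
      ∑ e, ∑ t ∈ Finset.range (B.len e), (if r = B.row e (t + 1) then B.v hE α ρ e t else 0) := by
  rw [B.rowSum_zval hE α ρ r, add_assoc]
  congr 1
  rw [← Finset.sum_add_distrib]
  refine Finset.sum_congr rfl fun e _ => ?_
  rw [← Finset.sum_add_distrib]
  refine Finset.sum_congr rfl fun t _ => ?_
  rw [mul_add, mul_ite, mul_ite, mul_one, mul_zero]

/-- Off the subdivision the zeroed assignment has the same row parities as `α`. [folklore] -/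
theorem rowVal_α₀_of_off {r : Fin m} (hr : ∀ e, r ∉ (B.P e).support) :
    rowVal E (B.α₀ hE α) r = rowVal E α r := by
  classical
  unfold rowVal
  refine Finset.sum_congr rfl fun j _ => ?_
  by_cases h : B.OnPath hE j
  · obtain ⟨e, t, ht, rfl⟩ := h
    have : (E r).1 (B.pv hE e t) = 0 := by
      rw [B.coeff_pv hE ht r, if_neg, if_neg, add_zero]
      · exact fun h => hr e (h ▸ B.row_mem_support e _)
      · exact fun h => hr e (h ▸ B.row_mem_support e _)
    rw [this, zero_mul, zero_mul]
  · simp only [α₀, if_neg h]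

/-- **Row equation off the subdivision** (GIRS Lemma 12: "if `v ∉ V'` then `α` assigns values to
all variables from `Par(v)` … `Par(v)[α]` is identically true"). [cite: GalesiEtAl2023, Lemma 12] -/
theorem rowSum_zval_off {r : Fin m} (hr : ∀ e, r ∉ (B.P e).support) (hα : rowVal E α r = (E r).2) :
    ∑ j, (E r).1 j * B.zval hE α ρ j = (E r).2 := by
  rw [B.rowSum_zval_split hE α ρ r, B.rowVal_α₀_of_off hE α hr, hα]
  have h1 := B.sum_off hE α ρ hr false
  have h2 := B.sum_off hE α ρ hr true
  simp only [Bool.false_eq_true, if_false, add_zero, if_true] at h1 h2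
  rw [h1, h2, add_zero, add_zero]

/-- **Row equation at a suppressed vertex** (an internal row of a path; GIRS Lemma 13: "`ψ_v[σ_v]`
is a tautology"). [cite: GalesiEtAl2023, Lemma 13] -/
theorem rowSum_zval_internal {e₀ : BEdge k} {t₀ : ℕ} (h0 : 0 < t₀) (h1 : t₀ < B.len e₀) :
    ∑ j, (E (B.row e₀ t₀)).1 j * B.zval hE α ρ j = (E (B.row e₀ t₀)).2 := by
  rw [B.rowSum_zval_split hE α ρ, B.sum_fst_internal hE α ρ h0 h1, B.sum_snd_internal hE α ρ h0 h1]
  simp only [v]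
  obtain ⟨s, rfl⟩ : ∃ s, t₀ = s + 1 := ⟨t₀ - 1, by omega⟩
  rw [Nat.add_sub_cancel, B.sgn_succ hE α e₀ s, q]
  generalize rowVal E (B.α₀ hE α) (B.row e₀ (s + 1)) = a
  generalize B.sgn hE α e₀ s = b
  generalize B.Yval hE α ρ e₀ = c
  generalize (E (B.row e₀ (s + 1))).2 = d
  revert a b c d; decide

/-- **Row equation at a left branch vertex** (the matching end `u_e`; GIRS Lemma 16: "the formula
`ψ'_w` is identically true" for `w = u_e`). [cite: GalesiEtAl2023, Lemma 16] -/
theorem rowSum_zval_left (u : Fin (k + 1) × Fin (k + 1)) :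
    ∑ j, (E (B.f (u, false))).1 j * B.zval hE α ρ j = (E (B.f (u, false))).2 := by
  rw [B.rowSum_zval_split hE α ρ, B.sum_fst_left hE α ρ u, B.sum_snd_left hE α ρ u, add_zero,
    sum_filter_lend_eq]
  simp only [v, sgn_zero, zero_add, Yval]
  rw [chL, q]
  generalize rowVal E (B.α₀ hE α) (B.f (u, false)) = a
  generalize ∑ ε ∈ leftEdges u, yv ρ ε = b
  generalize (E (B.f (u, false))).2 = d
  revert a b d; decide

/-- **Row equation at a right branch vertex** (the merged vertex `{u_e, v_e}`; GIRS Lemma 16: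
"`ψ'_w` is equivalent to the parity condition of the merged vertex in `T(M_n, f')`"), given the
grid equation at the cell. [cite: GalesiEtAl2023, Lemma 16] -/
theorem rowSum_zval_right (w : Fin (k + 1) × Fin (k + 1))
    (hgrid : ∑ ε ∈ leftEdges w, yv ρ ε + ∑ ε ∈ rightEdges w, yv ρ ε = B.charge hE α w) :
    ∑ j, (E (B.f (w, true))).1 j * B.zval hE α ρ j = (E (B.f (w, true))).2 := by
  rw [B.rowSum_zval_split hE α ρ, B.sum_fst_right hE α ρ w, B.sum_snd_right hE α ρ w, add_zero]
  simp only [v]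
  rw [Finset.sum_add_distrib, sum_filter_rend_eq (fun e => B.Yval hE α ρ e) w]
  simp only [Yval]
  rw [charge, chR] at hgrid
  rw [add_assoc (B.chL hE α w), hgrid, chL, q, q]
  generalize rowVal E (B.α₀ hE α) (B.f (w, true)) = a
  generalize rowVal E (B.α₀ hE α) (B.f (w, false)) = a'
  generalize ∑ x ∈ univ.filter (fun e : BEdge k => rend e = w), B.sgn hE α x (B.len x - 1) = b
  generalize (E (B.f (w, true))).2 = d
  generalize (E (B.f (w, false))).2 = d'
  revert a a' b d d'; decide

end RowEquations


end BrickEmbedding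

end Literature.Computability.MetaComplexity
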